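import Mathlib
import Summits.MatrixMultiplication.MatrixMultiplication.Theorems.SubgroupIdentityDesigns.Negative.PackingBridge
import Summits.MatrixMultiplication.MatrixMultiplication.Theorems.SubgroupIdentityDesigns.Negative.LevelCount

/-!
# The witness shell: designs beating `2 + ε` must sit at the wall
# (support lemma for stmt-MatrixMultiplication-14079; cell B2b-5 `b2b-lgcu-borel`, gen 11 —
# report `run/shared/lean/b2b/levelgraded-cu/ORACLE-g11.md` §G11-1b)

The tree's packing chain (`GradedDesignFamily.Negative.PackingLaw`: `D ≤ budget₂`, power mean
`budget₂^((2+ε)/2) ≤ N^(ε/2) budget_(2+ε)`, walls `2V² ≤ D³`) is usually quoted only through its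
end product `N^ε > 2^((2+ε)/3)`.  Its middle is the sharper, two-sided statement recorded here:

* `shell`, `shell_sq` — for a subgroup-TPP identity design in a bi-invariant `J ≤ ℂ^G` beating the
  exponent `2 + ε`:  `D^((2+ε)/2) < N^(ε/2) · V^((2+ε)/3)`, i.e. **`D³ < N^(3ε/(2+ε)) · V²`**
  (`D = dim J`, `N = #(Irr(G) ∩ J)`, `V = |H₁||H₂||H₃|`).  Together with the walls `2V² ≤ D³`:
  every witness lives in the SHELL `D³ / N^(3ε/(2+ε)) < V² ≤ D³ / 2`.
* `crux_shell` — the same for the crux `SubgroupIdentityDesigns` verbatim (`J = F_k|_{GL_m(𝔽_p)}`);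
  `crux_shell_count` — with the uniform count `N ≤ p^(4k²)` of `LevelCount`:
  `(dim F_k|_G)³ < (p^(4k²))^(3ε/(2+ε)) · V²`, so `V > (dim F_k|_G)^(3/2) · p^(-6k²ε/(2+ε))`.

Reading (ORACLE-g11 §G11-1b): a witness family needs identity designs whose volume is within the
factor `N^(3ε/(2(2+ε)))` (`≤ (2p^k)^(3ε/4)` with the sharp count) of the wall `D^(3/2)`, whereas every
design found so far (censuses of gens 7–11: `GL₂(𝔽₂), GL₂(𝔽₃), GL₂(𝔽₅), GL₃(𝔽₃)` at level one) has
`V ≤ 1.2 · D`.  The DESIGN-VOLUME GAP `V ≍ D` versus `V ≳ D^(3/2 − o(1))` is the whole open problem.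
Sorry-free; standard axioms.  VALUE = theorem (structural constraint on hypothetical witnesses),
NOT summit progress; the crux item stays open.
-/

set_option linter.dupNamespace false

noncomputable section

open scoped BigOperators Classical Matrix
open Module Literature.RepresentationTheory.FiniteGroups
open Literature.Barriers.MatrixMultiplication (SubgroupTPP)

namespace Summit.MatrixMultiplication.MatrixMultiplication.Theorems.SubgroupIdentityDesigns.Negative
namespace WitnessShell

open Summit.MatrixMultiplication.MatrixMultiplication.Theorems.GradedDesignFamily.Negative
  (finrank_le_gradedBudget_two gradedBudget_two_rpow_le)
open PackingBridge

section Abstract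

variable {G : Type} [Group G] [Fintype G]

/-- **The shell inequality** for a subgroup-TPP identity design in a bi-invariant `J` beating the
exponent `2 + ε`:  `D^((2+ε)/2) < N^(ε/2) · V^((2+ε)/3)`. [folklore] -/
theorem shell (J : Submodule ℂ (G → ℂ))
    (hJ : ∀ f ∈ J, ∀ a b : G, (fun g : G => f (a * g * b)) ∈ J)
    {H₁ H₂ H₃ : Subgroup G} (htpp : SubgroupTPP H₁ H₂ H₃)
    {f : G → ℂ} (hf : f ∈ J) (h1 : f 1 = 1)
    (h0 : ∀ a ∈ H₁, ∀ b ∈ H₂, ∀ c ∈ H₃, a * b * c ≠ 1 → f (a * b * c) = 0)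
    {ε : ℝ} (hε : 0 < ε)
    (hlt : (∑ᶠ χ ∈ irrChars G ∩ (J : Set (G → ℂ)), (χ 1).re ^ ((2 + ε) : ℝ)) <
      ((Nat.card H₁ * Nat.card H₂ * Nat.card H₃ : ℕ) : ℝ) ^ ((2 + ε) / 3)) :
    (finrank ℂ J : ℝ) ^ ((2 + ε) / 2) <
      ((irrChars G ∩ (J : Set (G → ℂ))).ncard : ℝ) ^ (ε / 2) *
        ((Nat.card H₁ * Nat.card H₂ * Nat.card H₃ : ℕ) : ℝ) ^ ((2 + ε) / 3) := by
  have hN : 2 ≤ (irrChars G ∩ (J : Set (G → ℂ))).ncard := two_le_ncard J hJ htpp hf h1 h0 hε hlt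
  have hNpos : (0 : ℝ) < ((irrChars G ∩ (J : Set (G → ℂ))).ncard : ℝ) ^ (ε / 2) :=
    Real.rpow_pos_of_pos (by exact_mod_cast (show 0 < _ by omega)) _
  have hD0 : (0 : ℝ) ≤ (finrank ℂ J : ℝ) := Nat.cast_nonneg _
  calc (finrank ℂ J : ℝ) ^ ((2 + ε) / 2)
      ≤ (∑ᶠ χ ∈ irrChars G ∩ (J : Set (G → ℂ)), (χ 1).re ^ ((2) : ℝ)) ^ ((2 + ε) / 2) :=
        Real.rpow_le_rpow hD0 (finrank_le_gradedBudget_two J hJ) (by positivity)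
    _ ≤ ((irrChars G ∩ (J : Set (G → ℂ))).ncard : ℝ) ^ (ε / 2) *
          (∑ᶠ χ ∈ irrChars G ∩ (J : Set (G → ℂ)), (χ 1).re ^ ((2 + ε) : ℝ)) :=
        gradedBudget_two_rpow_le J hε.le
    _ < _ := mul_lt_mul_of_pos_left hlt hNpos

/-- **The shell inequality, cubed**: `D³ < N^(3ε/(2+ε)) · V²` (with the walls `2V² ≤ D³` this pins
the volume of a witness to `D³/N^(3ε/(2+ε)) < V² ≤ D³/2`). [folklore] -/
theorem shell_sq (J : Submodule ℂ (G → ℂ))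
    (hJ : ∀ f ∈ J, ∀ a b : G, (fun g : G => f (a * g * b)) ∈ J)
    {H₁ H₂ H₃ : Subgroup G} (htpp : SubgroupTPP H₁ H₂ H₃)
    {f : G → ℂ} (hf : f ∈ J) (h1 : f 1 = 1)
    (h0 : ∀ a ∈ H₁, ∀ b ∈ H₂, ∀ c ∈ H₃, a * b * c ≠ 1 → f (a * b * c) = 0)
    {ε : ℝ} (hε : 0 < ε)
    (hlt : (∑ᶠ χ ∈ irrChars G ∩ (J : Set (G → ℂ)), (χ 1).re ^ ((2 + ε) : ℝ)) <
      ((Nat.card H₁ * Nat.card H₂ * Nat.card H₃ : ℕ) : ℝ) ^ ((2 + ε) / 3)) :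
    (finrank ℂ J : ℝ) ^ 3 <
      ((irrChars G ∩ (J : Set (G → ℂ))).ncard : ℝ) ^ (3 * ε / (2 + ε)) *
        ((Nat.card H₁ * Nat.card H₂ * Nat.card H₃ : ℕ) : ℝ) ^ 2 := by
  have h := shell J hJ htpp hf h1 h0 hε hlt
  have hD0 : (0 : ℝ) ≤ (finrank ℂ J : ℝ) := Nat.cast_nonneg _
  have hN0 : (0 : ℝ) ≤ ((irrChars G ∩ (J : Set (G → ℂ))).ncard : ℝ) := Nat.cast_nonneg _
  have hV0 : (0 : ℝ) ≤ ((Nat.card H₁ * Nat.card H₂ * Nat.card H₃ : ℕ) : ℝ) := Nat.cast_nonneg _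
  have hr : (0 : ℝ) < 6 / (2 + ε) := by positivity
  have h2 := Real.rpow_lt_rpow (Real.rpow_nonneg hD0 _) h hr
  rw [← Real.rpow_mul hD0, Real.mul_rpow (Real.rpow_nonneg hN0 _) (Real.rpow_nonneg hV0 _),
    ← Real.rpow_mul hN0, ← Real.rpow_mul hV0] at h2
  have h2e : (0 : ℝ) < 2 + ε := by linarith
  have e1 : (2 + ε) / 2 * (6 / (2 + ε)) = ((3 : ℕ) : ℝ) := by
    rw [div_mul_div_comm, div_eq_iff (by positivity)]; push_cast; ring
  have e2 : ε / 2 * (6 / (2 + ε)) = 3 * ε / (2 + ε) := by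
    rw [div_mul_div_comm, div_eq_div_iff (by positivity) (by positivity)]; ring
  have e3 : (2 + ε) / 3 * (6 / (2 + ε)) = ((2 : ℕ) : ℝ) := by
    rw [div_mul_div_comm, div_eq_iff (by positivity)]; push_cast; ring
  rw [e1, e2, e3, Real.rpow_natCast, Real.rpow_natCast] at h2
  exact h2

end Abstract

/-! ## The crux's own terms -/

section Crux

open Summit.MatrixMultiplication.MatrixMultiplication.Theorems.LieRankDesigns.Negative
  (GLm Mat levelSet budget)
open Summit.MatrixMultiplication.MatrixMultiplication.Theorems.LevelOneGL2Designs.Negative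
  (levelSubmodule levelSubmodule_bi_inv)

variable {p m k : ℕ} [hp : Fact p.Prime]

/-- **THE WITNESS SHELL FOR THE CRUX.**  Any witness of `SubgroupIdentityDesigns` at `ε` (subgroup
TPP, the design clause verbatim, `budget p m k (2+ε) < V^((2+ε)/3)`) satisfies
`(dim F_k|_{GL_m(𝔽_p)})³ < #(Irr(GL_m(𝔽_p)) ∩ F_k)^(3ε/(2+ε)) · V²`; with `PackingBridge.crux_walls`
(`2V² ≤ (dim F_k|_G)³`) the volume is pinned to the shell at the wall. -/
theorem crux_shell {ε : ℝ} (hε : 0 < ε) {H₁ H₂ H₃ : Subgroup (GLm p m)}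
    (htpp : SubgroupTPP H₁ H₂ H₃)
    (hdes : ∃ c : Mat p m → ℂ, (∀ M, k < M.rank → c M = 0) ∧
      (∑ M, c M * ZMod.stdAddChar (Matrix.trace (M * ((1 : GLm p m) : Mat p m)))) = 1 ∧
      ∀ a ∈ H₁, ∀ b ∈ H₂, ∀ g ∈ H₃, a * b * g ≠ 1 →
        (∑ M, c M * ZMod.stdAddChar
          (Matrix.trace (M * ((a * b * g : GLm p m) : Mat p m)))) = 0)
    (hlt : budget p m k (2 + ε) <
      ((Nat.card H₁ * Nat.card H₂ * Nat.card H₃ : ℕ) : ℝ) ^ ((2 + ε) / 3)) :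
    (finrank ℂ (levelSubmodule p m k) : ℝ) ^ 3 <
      ((irrChars (GLm p m) ∩ levelSet p m k).ncard : ℝ) ^ (3 * ε / (2 + ε)) *
        ((Nat.card H₁ * Nat.card H₂ * Nat.card H₃ : ℕ) : ℝ) ^ 2 := by
  obtain ⟨f, hf, h1, h0⟩ := exists_test hdes
  have h := shell_sq (levelSubmodule p m k) levelSubmodule_bi_inv htpp hf h1 h0 hε
    (by rwa [← budget_eq])
  rwa [coe_levelSubmodule] at h

/-- **Counted form**: with the uniform bound `#(Irr(GL_m(𝔽_p)) ∩ F_k) ≤ p^(4k²)` (`LevelCount`),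
every witness has `(dim F_k|_G)³ < (p^(4k²))^(3ε/(2+ε)) · V²` — the volume must be within the factor
`p^(6k²ε/(2+ε))` of the wall `(dim F_k|_G)^(3/2)`, uniformly in `m`. -/
theorem crux_shell_count {ε : ℝ} (hε : 0 < ε) {H₁ H₂ H₃ : Subgroup (GLm p m)}
    (htpp : SubgroupTPP H₁ H₂ H₃)
    (hdes : ∃ c : Mat p m → ℂ, (∀ M, k < M.rank → c M = 0) ∧
      (∑ M, c M * ZMod.stdAddChar (Matrix.trace (M * ((1 : GLm p m) : Mat p m)))) = 1 ∧
      ∀ a ∈ H₁, ∀ b ∈ H₂, ∀ g ∈ H₃, a * b * g ≠ 1 →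
        (∑ M, c M * ZMod.stdAddChar
          (Matrix.trace (M * ((a * b * g : GLm p m) : Mat p m)))) = 0)
    (hlt : budget p m k (2 + ε) <
      ((Nat.card H₁ * Nat.card H₂ * Nat.card H₃ : ℕ) : ℝ) ^ ((2 + ε) / 3)) :
    (finrank ℂ (levelSubmodule p m k) : ℝ) ^ 3 <
      ((p : ℝ) ^ (4 * k ^ 2)) ^ (3 * ε / (2 + ε)) *
        ((Nat.card H₁ * Nat.card H₂ * Nat.card H₃ : ℕ) : ℝ) ^ 2 := by
  have h := crux_shell hε htpp hdes hlt
  have hN : ((irrChars (GLm p m) ∩ levelSet p m k).ncard : ℝ) ≤ (p : ℝ) ^ (4 * k ^ 2) := by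
    have h1 := (LevelCount.ncard_irr_level_le (p := p) (m := m) (k := k)).trans
      (LevelCount.natCard_submodule_le (p := p) (k := k))
    exact_mod_cast h1
  have hexp : (0 : ℝ) ≤ 3 * ε / (2 + ε) := by positivity
  have hNr : ((irrChars (GLm p m) ∩ levelSet p m k).ncard : ℝ) ^ (3 * ε / (2 + ε)) ≤
      ((p : ℝ) ^ (4 * k ^ 2)) ^ (3 * ε / (2 + ε)) :=
    Real.rpow_le_rpow (Nat.cast_nonneg _) hN hexp
  have hV0 : (0 : ℝ) ≤ ((Nat.card H₁ * Nat.card H₂ * Nat.card H₃ : ℕ) : ℝ) ^ 2 := by positivity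
  exact h.trans_le (mul_le_mul_of_nonneg_right hNr hV0)

end Crux

end WitnessShell
end Summit.MatrixMultiplication.MatrixMultiplication.Theorems.SubgroupIdentityDesigns.Negative
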